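import Summits.KontsevichZagierPeriods.KontsevichZagierPeriods.Theorems.TerasomaMultiplicationBetaCancellationStubTameFormAux24

/-!
# `BetaCancellation` (stmt-KontsevichZagierPeriods-13633), line `divisor-slicing-transshipment` — stub `stub_tameForm`, auxiliary file 25: shadow bookkeeping for rule (3)

* `Shadow.of_partition'` — `Shadow.of_partition` for an arbitrary finite index type;
* `Shadow.of_restrict_conull` — a representation and its restriction to a conull semialgebraic
  subset have the same shadow;
* `Shadow.of_integrandSum` — iterated rule (1b): `[σ, ∑ hᵢ] − ∑ [σ, hᵢ]` has vanishing shadow;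
* `isSemialgebraic_cell`, `exists_goodBase` — the open cell between two semialgebraic functions is
  semialgebraic, and finitely many semialgebraic functions on an open semialgebraic base are
  differentiable on a conull open semialgebraic sub-base.

References: M. Kontsevich, D. Zagier, *Periods* (2001), §1.2; crux NOTES c6 (F13).
-/

noncomputable section

-- `Summit.KontsevichZagierPeriods.KontsevichZagierPeriods.…` is the tree's mandated layout (single-conjunct summit).
set_option linter.dupNamespace false

namespace Summit.KontsevichZagierPeriods.KontsevichZagierPeriods.BetaCancellationDivisorSlicing

open MeasureTheory Set Function Filter
open scoped Topology
open Literature.NumberTheory.Transcendental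
open Literature.NumberTheory.Transcendental.KZ
open Literature.ModelTheory.ExponentialFields (IsSemialgebraic isSemialgebraic_univ)

variable {n : ℕ}

namespace Shadow

/-- `Shadow.of_partition` over an arbitrary finite index type. [cite: KontsevichZagier2001, §1.2 rule (1)] -/
theorem of_partition' {ι : Type} [Fintype ι] (r : IntegralRep n) (R : ι → IntegralRep n)
    (hsub : ∀ k, (R k).domain ⊆ r.domain)
    (hint : ∀ k, EqOn (R k).integrand r.integrand (R k).domain)
    (hdisj : ∀ k k', k ≠ k' → volume ((R k).domain ∩ (R k').domain) = 0)
    (hcov : volume (r.domain \ ⋃ k, (R k).domain) = 0) :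
    Nonempty (Shadow (of r - ∑ k, of (R k))) := by
  classical
  let e := Fintype.equivFin ι
  obtain ⟨S⟩ := of_partition r (fun k => R (e.symm k)) (fun k => hsub _) (fun k => hint _)
    (fun k k' hkk => hdisj _ _ fun h => hkk (e.symm.injective h)) (by
      convert hcov using 3
      ext x; simp only [mem_iUnion]
      exact ⟨fun ⟨k, hk⟩ => ⟨e.symm k, hk⟩, fun ⟨k, hk⟩ => ⟨e k, by simpa using hk⟩⟩)
  refine S.congr ?_
  rw [← e.symm.sum_comp]

/-- **A representation and its restriction to a conull semialgebraic subset have the same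
shadow.** [cite: KontsevichZagier2001, §1.2 rule (1)] -/
theorem of_restrict_conull (r : IntegralRep n) {E : Set (Fin n → ℝ)} (hE : IsSemialgebraic ℚ E) (hEr : E ⊆ r.domain)
    (hvol : volume (r.domain \ E) = 0) : Nonempty (Shadow (of r - of (r.restrict E hE hEr))) := by
  obtain ⟨S⟩ := of_partition r (K := 1) (fun _ => r.restrict E hE hEr) (fun _ => hEr) (fun _ _ _ => rfl)
    (fun k k' h => (h (Subsingleton.elim k k')).elim) (by simpa [iUnion_const] using hvol)
  exact S.congr (by simp)

/-- **Iterated rule (1b)**: `[σ, ∑ᵢ hᵢ] − ∑ᵢ [σ, hᵢ]` has vanishing shadow.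
[cite: KontsevichZagier2001, §1.2 rule (1)] -/
theorem of_integrandSum {ι : Type} [Fintype ι] [DecidableEq ι] (Y : IntegralRep n) (X : ι → IntegralRep n)
    (hd : ∀ i, (X i).domain = Y.domain) (hsum : ∀ z ∈ Y.domain, Y.integrand z = ∑ i, (X i).integrand z) :
    Nonempty (Shadow (of Y - ∑ i, of (X i))) := by
  suffices h : ∀ (s : Finset ι) (Y : IntegralRep n), (∀ i, (X i).domain = Y.domain) →
      (∀ z ∈ Y.domain, Y.integrand z = ∑ i ∈ s, (X i).integrand z) → Nonempty (Shadow (of Y - ∑ i ∈ s, of (X i))) from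
    h Finset.univ Y hd hsum
  intro s
  induction s using Finset.induction_on with
  | empty =>
    intro Y _ hsum
    simp only [Finset.sum_empty, sub_zero]
    exact of_eqOn_zero Y fun z hz => by simpa using hsum z hz
  | insert a s ha ih =>
    intro Y hd hsum
    -- the partial sum representation
    have hsa : IsSemialgebraicFunOn ℚ Y.domain (fun z => ∑ i ∈ s, (X i).integrand z) := by
      have : ∀ t : Finset ι, IsSemialgebraicFunOn ℚ Y.domain (fun z => ∑ i ∈ t, (X i).integrand z) := by
        intro t
        induction t using Finset.induction_on with
        | empty =>
          simpa using (isSemialgebraicFunOn_aeval Y.isSemialgebraic_domain 0).congr (fun z _ => by simp)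
        | insert b t hb iht =>
          have hX : IsSemialgebraicFunOn ℚ Y.domain (X b).integrand := hd b ▸ (X b).isSemialgebraicFunOn_integrand
          convert IsSemialgebraicFunOn.add_holds hX iht using 1
          funext z; simp [Finset.sum_insert hb]
      exact this s
    have hint : IntegrableOn (fun z => ∑ i ∈ s, (X i).integrand z) Y.domain := by
      have := integrable_finsetSum s (μ := volume.restrict Y.domain) (f := fun i => (X i).integrand)
        (fun i _ => by have := (X i).integrableOn; rw [hd i] at this; exact this)
      simpa [IntegrableOn, Finset.sum_apply] using this
    obtain ⟨Y', hY'd, hY'i⟩ := exists_rep Y.isSemialgebraic_domain hsa hint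
    obtain ⟨S1⟩ := of_mem_integrandAddRel ⟨n, Y, X a, Y', hd a, hY'd, fun z hz => by
      simp only [Pi.add_apply, hY'i, hsum z hz, Finset.sum_insert ha], rfl⟩
    obtain ⟨S2⟩ := ih Y' (fun i => by rw [hd i, hY'd]) (fun z _ => by simp [hY'i])
    obtain ⟨S3⟩ := S1.add S2
    refine S3.congr ?_
    rw [Finset.sum_insert ha]; abel

end Shadow

/-- The open cell between two semialgebraic functions over a semialgebraic base is semialgebraic.
[cite: BCR1998, §2.2] -/
theorem isSemialgebraic_cell {S : Set (Fin n → ℝ)} (hS : IsSemialgebraic ℚ S) {lo hi : (Fin n → ℝ) → ℝ}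
    (hlo : IsSemialgebraicFunOn ℚ S lo) (hhi : IsSemialgebraicFunOn ℚ S hi) :
    IsSemialgebraic ℚ {z : Fin (n + 1) → ℝ | (Fin.init z : Fin n → ℝ) ∈ S ∧ lo (Fin.init z) < z (Fin.last n) ∧
      z (Fin.last n) < hi (Fin.init z)} := by
  have hcyl : IsSemialgebraic ℚ {z : Fin (n + 1) → ℝ | (Fin.init z : Fin n → ℝ) ∈ S} := hS.preimage_comp Fin.castSucc
  have hloi : IsSemialgebraicFunOn ℚ {z : Fin (n + 1) → ℝ | (Fin.init z : Fin n → ℝ) ∈ S} (fun z => lo (Fin.init z)) :=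
    hlo.comp_init_mono hcyl fun _ h => h
  have hhii : IsSemialgebraicFunOn ℚ {z : Fin (n + 1) → ℝ | (Fin.init z : Fin n → ℝ) ∈ S} (fun z => hi (Fin.init z)) :=
    hhi.comp_init_mono hcyl fun _ h => h
  have hli := isSemialgebraicFunOn_apply hcyl (Fin.last n)
  convert (isSemialgebraic_sep_lt' hloi hli).inter (isSemialgebraic_sep_lt' hli hhii) using 1
  ext z; simp only [mem_setOf_eq, mem_inter_iff]; tauto

/-- **A conull open semialgebraic good base for finitely many semialgebraic functions.**
[cite: BochnakCosteRoy1998, §2.9] -/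
theorem exists_goodBase {S : Set (Fin n → ℝ)} (hSo : IsOpen S) (hS : IsSemialgebraic ℚ S) {ι : Type} [Fintype ι]
    (G : ι → (Fin n → ℝ) → ℝ) (need : ι → Prop) (hG : ∀ i, need i → IsSemialgebraicFunOn ℚ S (G i)) :
    ∃ S' : Set (Fin n → ℝ), S' ⊆ S ∧ IsOpen S' ∧ IsSemialgebraic ℚ S' ∧ volume (S \ S') = 0 ∧
      ∀ i, need i → DifferentiableOn ℝ (G i) S' := by
  classical
  have hU : ∀ i, ∃ U : Set (Fin n → ℝ), IsOpen U ∧ IsSemialgebraic ℚ U ∧ volume (S \ U) = 0 ∧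
      (need i → DifferentiableOn ℝ (G i) (S ∩ U)) := by
    intro i
    by_cases hi : need i
    · obtain ⟨U, hUS, hUo, hUsa, hsmooth, -, hnull⟩ := exists_isOpen_contDiffOn hS (hG i hi)
      refine ⟨U, hUo, hUsa, hnull, fun _ => ?_⟩
      rw [inter_eq_right.mpr hUS]
      exact hsmooth.differentiableOn (by simp)
    · exact ⟨univ, isOpen_univ, isSemialgebraic_univ, by simp, fun h => (hi h).elim⟩
  choose U hUo hUsa hUnull hUd using hU
  refine ⟨S ∩ ⋂ i, U i, inter_subset_left, hSo.inter (isOpen_iInter_of_finite hUo), ?_, ?_, fun i hi => ?_⟩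
  · convert hS.inter (Literature.ModelTheory.ExponentialFields.IsSemialgebraic.biInter Finset.univ U fun i _ => hUsa i) using 2
    ext x; simp
  · have : S \ (S ∩ ⋂ i, U i) ⊆ ⋃ i, (S \ U i) := by
      intro x hx
      simp only [Set.mem_sdiff, mem_inter_iff, mem_iInter, not_and, not_forall] at hx
      obtain ⟨i, hi⟩ := hx.2 hx.1
      exact mem_iUnion.mpr ⟨i, hx.1, hi⟩
    exact measure_mono_null this (measure_iUnion_null_iff.mpr hUnull)
  · exact (hUd i hi).mono fun x hx => ⟨hx.1, mem_iInter.mp hx.2 i⟩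

/-! ### Headline -/

/-- Registered helper goal of the stub `stub_tameForm`: a representation and its restriction to a
conull semialgebraic subset have the same shadow. [cite: KontsevichZagier2001, §1.2 rule (1)] -/
theorem tameForm_aux_restrictConull : ∀ {n : ℕ} (r : IntegralRep n) {E : Set (Fin n → ℝ)} (hE : IsSemialgebraic ℚ E) (hEr : E ⊆ r.domain), volume (r.domain \ E) = 0 → Nonempty (Shadow (of r - of (r.restrict E hE hEr))) :=
  fun r _ hE hEr hvol => Shadow.of_restrict_conull r hE hEr hvol

end Summit.KontsevichZagierPeriods.KontsevichZagierPeriods.BetaCancellationDivisorSlicing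

end
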